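import Mathlib.Analysis.SpecialFunctions.Pow.Real
import Literature.Geometry.DiscreteGeometry.TriangularLatticeRows
import HarnessLib

/-!
# Supported-site excess in the triangular label lattice (helper for the refined word-uniform
# surface rung toward `StackingLiminf`, stmt-Ventures-19145)

Cell `crystal3d-full`, venture `Summits/Ventures/Crystal3D`.  For a finite label set
`S ⊂ ℤ × ℤ` and a sign `s = ±1`, call `w ∈ S` SUPPORTED if `w + (s, 0) ∈ S` and `w + (0, s) ∈ S`
(i.e. the triangle `{w, w + (s,0), w + (0,s)}` lies in `S`).  Across an interface of a Barlow
stacking, a ball of the upper layer touches all three of its possible lower neighbours exactly when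
its label triangle lies in the lower layer's label set; the number of such triangles is what limits
the cross-layer contacts beyond the terrace count.

**Theorem** (`card_supported_le_sub_sqrt`). The number `t` of supported sites satisfies
`t ≤ |S| − √|S|`.  Proof: in every occupied row at least one site (the last one in direction `s`)
is unsupported, so `t ≤ |S| − #rows` (tree: `HarborthSpiral.horizBonds_add_card_rows_le`);
likewise `t ≤ |S| − #columns` (transpose); and `|S| ≤ #rows · #columns`, whence
`(|S| − t)² ≥ #rows · #columns ≥ |S|`.

(The sharp excess is `≈ √(2|S|)`, attained by lattice triangles — a Macaulay/Kruskal–Katona-type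
statement not attempted here.)

WHAT THIS IS NOT: anything about packings by itself; pure counting on `ℤ²`.
-/

noncomputable section

namespace Summit.Ventures.Crystal3D.Theorems

open Finset
open Literature.Geometry.DiscreteGeometry.HarborthSpiral (horizBonds horizBonds_add_card_rows_le)

/-- Counting a bond from either end: `#{q ∈ S : q + u ∈ S} = #{q ∈ S : q − u ∈ S}`. -/
theorem card_filter_add_mem_eq (S : Finset (ℤ × ℤ)) (u : ℤ × ℤ) :
    (S.filter fun q => q + u ∈ S).card = (S.filter fun q => q - u ∈ S).card := by
  have h : (S.filter fun q => q - u ∈ S) = (S.filter fun q => q + u ∈ S).image (· + u) := by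
    ext q
    simp only [mem_filter, mem_image]
    constructor
    · rintro ⟨h1, h2⟩
      exact ⟨q - u, ⟨h2, by simpa using h1⟩, by simp⟩
    · rintro ⟨q', ⟨h1, h2⟩, rfl⟩
      exact ⟨h2, by simpa using h1⟩
  rw [h, card_image_of_injective _ (add_left_injective u)]

/-- Horizontal neighbours in direction `s = ±1`: `#{q ∈ S : (q.1 + s, q.2) ∈ S} + #rows ≤ |S|`. -/
theorem card_filter_horiz_add_rows_le (S : Finset (ℤ × ℤ)) {s : ℤ} (hs : s = 1 ∨ s = -1) :
    (S.filter fun q => (q.1 + s, q.2) ∈ S).card + (S.image Prod.snd).card ≤ S.card := by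
  have h1 := horizBonds_add_card_rows_le S
  rcases hs with rfl | rfl
  · exact h1
  · have eL : (S.filter fun q => (q.1 + -1, q.2) ∈ S) = S.filter (fun q => q - (1, 0) ∈ S) := by
      ext ⟨q1, q2⟩
      simp only [mem_filter, Prod.mk_sub_mk, sub_zero, ← sub_eq_add_neg]
    have eR : (S.filter fun q => (q.1 + 1, q.2) ∈ S) = S.filter (fun q => q + (1, 0) ∈ S) := by
      ext ⟨q1, q2⟩
      simp only [mem_filter, Prod.mk_add_mk, add_zero]
    have e : (S.filter fun q => (q.1 + -1, q.2) ∈ S).card = horizBonds S := by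
      rw [horizBonds, eL, eR, card_filter_add_mem_eq]
    rw [e]; exact h1

/-- Vertical neighbours in direction `s = ±1`: `#{q ∈ S : (q.1, q.2 + s) ∈ S} + #columns ≤ |S|`
(the horizontal statement for the transposed set). -/
theorem card_filter_vert_add_cols_le (S : Finset (ℤ × ℤ)) {s : ℤ} (hs : s = 1 ∨ s = -1) :
    (S.filter fun q => (q.1, q.2 + s) ∈ S).card + (S.image Prod.fst).card ≤ S.card := by
  classical
  set T := S.image Prod.swap with hT
  have hmemT : ∀ q : ℤ × ℤ, q ∈ T ↔ q.swap ∈ S := by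
    intro q
    rw [hT, mem_image]
    constructor
    · rintro ⟨p, hp, rfl⟩; rwa [Prod.swap_swap]
    · intro h; exact ⟨q.swap, h, Prod.swap_swap q⟩
  have hTcard : T.card = S.card := card_image_of_injective _ Prod.swap_injective
  have hrows : T.image Prod.snd = S.image Prod.fst := by
    rw [hT, image_image]; rfl
  have hfilt : (T.filter fun q => (q.1 + s, q.2) ∈ T).card =
      (S.filter fun q => (q.1, q.2 + s) ∈ S).card := by
    have : (T.filter fun q => (q.1 + s, q.2) ∈ T) =
        (S.filter fun q => (q.1, q.2 + s) ∈ S).image Prod.swap := by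
      ext ⟨q1, q2⟩
      simp only [mem_filter, mem_image, hmemT, Prod.swap_prod_mk, Prod.exists, Prod.mk.injEq]
      constructor
      · rintro ⟨h1, h2⟩; exact ⟨q2, q1, ⟨h1, h2⟩, rfl, rfl⟩
      · rintro ⟨a, b, ⟨h1, h2⟩, rfl, rfl⟩; exact ⟨h1, h2⟩
    rw [this, card_image_of_injective _ Prod.swap_injective]
  have h := card_filter_horiz_add_rows_le T hs
  rw [hfilt, hrows, hTcard] at h
  exact h

/-- `|S| ≤ #columns · #rows` (a label set lies in the product of its two projections). -/
theorem card_le_card_image_fst_mul_snd (S : Finset (ℤ × ℤ)) :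
    S.card ≤ (S.image Prod.fst).card * (S.image Prod.snd).card := by
  rw [← card_product]
  exact card_le_card fun q hq => mem_product.2 ⟨mem_image_of_mem _ hq, mem_image_of_mem _ hq⟩

/-- **Supported-site excess.** For `s = ±1`, the sites `w ∈ S` with `w + (s,0) ∈ S` and
`w + (0,s) ∈ S` number at most `|S| − √|S|`. -/
theorem card_supported_le_sub_sqrt (S : Finset (ℤ × ℤ)) {s : ℤ} (hs : s = 1 ∨ s = -1) :
    ((S.filter fun q => (q.1 + s, q.2) ∈ S ∧ (q.1, q.2 + s) ∈ S).card : ℝ) ≤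
      (S.card : ℝ) - Real.sqrt (S.card : ℝ) := by
  set t := (S.filter fun q => (q.1 + s, q.2) ∈ S ∧ (q.1, q.2 + s) ∈ S).card with ht
  set R := (S.image Prod.snd).card
  set C := (S.image Prod.fst).card
  have htR : t + R ≤ S.card := by
    refine le_trans (Nat.add_le_add_right (card_le_card fun q hq => ?_) R)
      (card_filter_horiz_add_rows_le S hs)
    exact mem_filter.2 ⟨(mem_filter.1 hq).1, (mem_filter.1 hq).2.1⟩
  have htC : t + C ≤ S.card := by
    refine le_trans (Nat.add_le_add_right (card_le_card fun q hq => ?_) C)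
      (card_filter_vert_add_cols_le S hs)
    exact mem_filter.2 ⟨(mem_filter.1 hq).1, (mem_filter.1 hq).2.2⟩
  have hRC : S.card ≤ C * R := card_le_card_image_fst_mul_snd S
  -- `(|S| − t)² ≥ C·R ≥ |S|`
  have hR' : (R : ℝ) ≤ S.card - t := by
    have : ((t + R : ℕ) : ℝ) ≤ S.card := by exact_mod_cast htR
    push_cast at this; linarith
  have hC' : (C : ℝ) ≤ S.card - t := by
    have : ((t + C : ℕ) : ℝ) ≤ S.card := by exact_mod_cast htC
    push_cast at this; linarith
  have hRC' : (S.card : ℝ) ≤ (C : ℝ) * R := by exact_mod_cast hRC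
  have hsq : (S.card : ℝ) ≤ (S.card - t) ^ 2 := by
    rw [pow_two]
    exact hRC'.trans (mul_le_mul hC' hR' (Nat.cast_nonneg (α := ℝ) R)
      (by linarith [Nat.cast_nonneg (α := ℝ) C]))
  have h0 : (0 : ℝ) ≤ S.card - t := le_trans (Nat.cast_nonneg (α := ℝ) R) hR'
  have := Real.sqrt_le_sqrt hsq
  rw [Real.sqrt_sq h0] at this
  linarith

end Summit.Ventures.Crystal3D.Theorems

end
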